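import Mathlib
import HarnessLib
import Summits.Ventures.LatticeQCDFlow.Scaling.AutoregressiveGaugeAllClosingScorecard
import Summits.Ventures.LatticeQCDFlow.Scaling.TorusClosingLinks

/-!
# LatticeQCDFlow / Scaling — the all-closing heat-bath autoregression along a MAXIMALLY CLOSING order:
# a closing assignment with `Σ_ℓ (#Cℓ − 1) = k_min(d, L)` exists, so its exact sampler has
# `τ_int ≤ K − 1/2` with `K ≤ (M/m)^{k_min(d,L)}` — the optimal one-plaquette ceiling, with a smaller constant

HONEST FRAMING: exact (Metropolis-corrected) sampling algorithms for lattice gauge theory;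
figures of merit are autocorrelation/cost numbers at stated couplings and volumes; no
continuum-physics claim.

Venture `LatticeQCDFlow` (cell pub-lqcd), topic `Scaling`, FANOUT row 30 (lean-1, GEN-27) — OUR WORK on
THEORY-2.md §4 row C5.  `TorusClosingLinks` (this generation): along every order at most `(d−1)(L^d − 1)` links
close a plaquette, with equality for a compatible order of the Morse structure.  `AutoregressiveGaugeAllClosing*`:
the all-closing conditioner along a closing assignment `(T, pos, C)` is a normalised proposal whose exact
sampler has `τ_int ≤ K − 1/2`, `K = ∏_ℓ c_{#Cℓ}/(m^{#Cℓ−1}·c) ≤ (M/m)^{Σ_ℓ (#Cℓ−1)}`.  Here the two are joined: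

* **`exists_closingAssignment_of_order`** — every list `l` of all links and every last-link selector give a
  closing assignment: `T` = the closing links, `C ℓ` = the plaquettes closed by `ℓ`, `pos = idxOf`; its sets
  are non-empty, contain their link, have all other links earlier, PARTITION the plaquettes, and
  `Σ_{ℓ∈T} #Cℓ = #plaquettes`;
* **`card_plaquette_eq_kmin_add`** — `#plaquettes = k_min(d, L) + (d−1)(L^d − 1)`;
* **`exists_closingAssignment_kmin`** — along the maximally closing order of `TorusClosingLinks` the assignment
  has `Σ_{ℓ∈T} (#Cℓ − 1) = k_min(d, L)` EXACTLY: the all-closing sampler's constant satisfies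
  `K ≤ (M/m)^{k_min(d,L)}` (`allClosing_constant_le`);
* **`exists_allClosing_sampler_ceiling`** — hence the exact sampler of the all-closing autoregression along that
  order has `τ_int(f) ≤ (M/m)^{k_min(d,L)} − 1/2` for every bounded centred `f` — the ceiling of the OPTIMAL
  one-plaquette heat-bath sampler (GEN-25's `AutoregressiveGaugeHeatBathOptimal`), reached by a conditioner that
  needs no ranked structure, and with a strictly smaller constant as soon as one link closes two plaquettes.

No `def`, no `sorry`, nothing cited as a fact beyond the tree.
-/

namespace Summit.Ventures.LatticeQCDFlow.Theory2.Autoregressive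

open MeasureTheory ProbabilityTheory Function Finset
open Literature.MathematicalPhysics.QuantumFieldTheory Literature.MathematicalPhysics.QuantumLattice
open Summit.Ventures.LatticeQCDFlow.Exactness Summit.Ventures.LatticeQCDFlow.Scoring

variable {d L : ℕ} [NeZero L]

/-- **Every order and last-link selector give a closing assignment that partitions the plaquettes.**
[ours] -/
theorem exists_closingAssignment_of_order (l : List (Edge d L)) (hall : ∀ e : Edge d L, e ∈ l)
    (last : Plaquette d L → Edge d L)
    (hmem : ∀ p : Plaquette d L, last p ∈ ({(p.1, p.2.1.1), (p.1.shift p.2.1.1, p.2.1.2),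
        (p.1.shift p.2.1.2, p.2.1.1), (p.1, p.2.1.2)} : Finset (Edge d L)))
    (hmax : ∀ p : Plaquette d L, ∀ e' ∈ ({(p.1, p.2.1.1), (p.1.shift p.2.1.1, p.2.1.2),
        (p.1.shift p.2.1.2, p.2.1.1), (p.1, p.2.1.2)} : Finset (Edge d L)), l.idxOf e' ≤ l.idxOf (last p)) :
    ∃ (T : Finset (Edge d L)) (C : Edge d L → Finset (Plaquette d L)),
      T = Finset.univ.image last ∧
      (∀ ℓ ∈ T, (C ℓ).Nonempty) ∧
      (∀ ℓ ∈ T, ∀ p ∈ C ℓ, ℓ ∈ ({(p.1, p.2.1.1), (p.1.shift p.2.1.1, p.2.1.2),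
        (p.1.shift p.2.1.2, p.2.1.1), (p.1, p.2.1.2)} : Finset (Edge d L))) ∧
      (∀ ℓ ∈ T, ∀ p ∈ C ℓ, ∀ e ∈ ({(p.1, p.2.1.1), (p.1.shift p.2.1.1, p.2.1.2),
        (p.1.shift p.2.1.2, p.2.1.1), (p.1, p.2.1.2)} : Finset (Edge d L)), e ≠ ℓ → l.idxOf e < l.idxOf ℓ) ∧
      (∀ ℓ ∈ T, ∀ ℓ' ∈ T, ℓ ≠ ℓ' → Disjoint (C ℓ) (C ℓ')) ∧
      (∀ p : Plaquette d L, ∃ ℓ ∈ T, p ∈ C ℓ) ∧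
      ∑ ℓ ∈ T, (C ℓ).card = Fintype.card (Plaquette d L) := by
  classical
  refine ⟨Finset.univ.image last, fun ℓ => Finset.univ.filter (fun p => last p = ℓ), rfl, ?_, ?_, ?_, ?_, ?_, ?_⟩
  · intro ℓ hℓ
    obtain ⟨p, -, hp⟩ := Finset.mem_image.1 hℓ
    exact ⟨p, Finset.mem_filter.2 ⟨Finset.mem_univ _, hp⟩⟩
  · intro ℓ _ p hp
    rw [← (Finset.mem_filter.1 hp).2]
    exact hmem p
  · intro ℓ _ p hp e he hne
    have hlp : last p = ℓ := (Finset.mem_filter.1 hp).2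
    rw [← hlp] at hne ⊢
    refine lt_of_le_of_ne (hmax p e he) fun heq => hne ?_
    exact (List.idxOf_inj (hall e)).1 heq
  · intro ℓ _ ℓ' _ hne
    exact Finset.disjoint_filter.2 fun p _ h1 h2 => hne (h1.symm.trans h2)
  · intro p
    exact ⟨last p, Finset.mem_image.2 ⟨p, Finset.mem_univ _, rfl⟩,
      Finset.mem_filter.2 ⟨Finset.mem_univ _, rfl⟩⟩
  · rw [← Finset.card_univ, Finset.card_eq_sum_card_image last Finset.univ]

/-- **`#plaquettes = k_min(d, L) + (d−1)(L^d − 1)`** on `(ℤ/L)^d` (`2·#plaquettes = d(d−1)·L^d`). [ours] -/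
theorem card_plaquette_eq_kmin_add :
    Fintype.card (Plaquette d L) = (d - 1) * (d - 2) / 2 * L ^ d + (d - 1) + (d - 1) * (L ^ d - 1) := by
  have hP := two_mul_card_plaquette d L
  rw [Summit.Ventures.LatticeQCDFlow.Runbook.card_site] at hP
  have hX : 1 ≤ L ^ d := Nat.one_le_pow _ _ (Nat.pos_of_ne_zero (NeZero.ne L))
  rcases Nat.lt_or_ge d 2 with hd | hd
  · interval_cases d
    · simp only [Nat.zero_sub, zero_mul, Nat.zero_div, zero_add, mul_zero] at hP ⊢
      omega
    · simp only [Nat.sub_self, zero_mul, Nat.zero_div, mul_zero, add_zero] at hP ⊢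
      omega
  · obtain ⟨e, rfl⟩ : ∃ e, d = e + 2 := ⟨d - 2, by omega⟩
    obtain ⟨Y, hY⟩ : ∃ Y, L ^ (e + 2) = Y + 1 := ⟨L ^ (e + 2) - 1, by omega⟩
    simp only [Nat.add_sub_cancel, show e + 2 - 1 = e + 1 from rfl] at hP ⊢
    rw [hY] at hP ⊢
    simp only [Nat.add_sub_cancel]
    have h2 : (e + 1) * e / 2 * 2 = (e + 1) * e := by
      have := Nat.div_mul_cancel (Nat.even_mul_pred_self (e + 1)).two_dvd
      simpa [Nat.add_sub_cancel, mul_comm] using this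
    nlinarith [hP, h2]

/-- **A closing assignment with `Σ_ℓ (#Cℓ − 1) = k_min(d, L)` exists** (`L ≥ 2`): the maximally closing order of
`TorusClosingLinks.exists_order_card_image_lastLink_eq` with any last-link selector; along it the all-closing
heat-bath autoregression is a normalised proposal whose exact sampler has `τ_int ≤ K − 1/2` with
`K ≤ (M/m)^{k_min(d,L)}` (`AutoregressiveGaugeAllClosingScorecard`). [ours] -/
theorem exists_closingAssignment_kmin (hL : 2 ≤ L) :
    ∃ (l : List (Edge d L)) (T : Finset (Edge d L)) (C : Edge d L → Finset (Plaquette d L)),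
      l.Nodup ∧ (∀ e : Edge d L, e ∈ l) ∧
      (∀ ℓ ∈ T, (C ℓ).Nonempty) ∧
      (∀ ℓ ∈ T, ∀ p ∈ C ℓ, ℓ ∈ ({(p.1, p.2.1.1), (p.1.shift p.2.1.1, p.2.1.2),
        (p.1.shift p.2.1.2, p.2.1.1), (p.1, p.2.1.2)} : Finset (Edge d L))) ∧
      (∀ ℓ ∈ T, ∀ p ∈ C ℓ, ∀ e ∈ ({(p.1, p.2.1.1), (p.1.shift p.2.1.1, p.2.1.2),
        (p.1.shift p.2.1.2, p.2.1.1), (p.1, p.2.1.2)} : Finset (Edge d L)), e ≠ ℓ → l.idxOf e < l.idxOf ℓ) ∧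
      (∀ ℓ ∈ T, ∀ ℓ' ∈ T, ℓ ≠ ℓ' → Disjoint (C ℓ) (C ℓ')) ∧
      (∀ p : Plaquette d L, ∃ ℓ ∈ T, p ∈ C ℓ) ∧
      ∑ ℓ ∈ T, ((C ℓ).card - 1) = (d - 1) * (d - 2) / 2 * L ^ d + (d - 1) := by
  classical
  obtain ⟨l, hnodup, hall, hcount⟩ := exists_order_card_image_lastLink_eq (d := d) hL
  -- a last-link selector for `l`
  have hex : ∀ p : Plaquette d L, ∃ e ∈ ({(p.1, p.2.1.1), (p.1.shift p.2.1.1, p.2.1.2),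
        (p.1.shift p.2.1.2, p.2.1.1), (p.1, p.2.1.2)} : Finset (Edge d L)),
      ∀ e' ∈ ({(p.1, p.2.1.1), (p.1.shift p.2.1.1, p.2.1.2),
        (p.1.shift p.2.1.2, p.2.1.1), (p.1, p.2.1.2)} : Finset (Edge d L)), l.idxOf e' ≤ l.idxOf e := fun p =>
    Finset.exists_max_image _ (fun e => l.idxOf e) ⟨(p.1, p.2.1.1), by simp⟩
  choose last hmem hmax using hex
  obtain ⟨T, C, hT, hne, hCe, hCpos, hdisj, hcover, hsum⟩ :=
    exists_closingAssignment_of_order l hall last hmem hmax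
  refine ⟨l, T, C, hnodup, hall, hne, hCe, hCpos, hdisj, hcover, ?_⟩
  have hTcard : T.card = (d - 1) * (L ^ d - 1) := by rw [hT]; exact hcount last hmem hmax
  have hsum' : ∑ ℓ ∈ T, ((C ℓ).card - 1) + T.card = ∑ ℓ ∈ T, (C ℓ).card := by
    rw [Finset.card_eq_sum_ones, ← Finset.sum_add_distrib]
    exact Finset.sum_congr rfl fun ℓ hℓ => Nat.sub_add_cancel (Finset.card_pos.2 (hne ℓ hℓ))
  have hP := card_plaquette_eq_kmin_add (d := d) (L := L)
  omega

/-! ## The ceiling `(M/m)^{k_min} − 1/2` for the all-closing sampler along the maximally closing order -/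

section Sampler

variable {G : Type*} [Group G] [TopologicalSpace G] [IsTopologicalGroup G]
  [CompactSpace G] [SecondCountableTopology G] [MeasurableSpace G] [BorelSpace G]

/-- **THE ALL-CLOSING EXACT SAMPLER MATCHES THE OPTIMAL ONE-PLAQUETTE CEILING.**  `L ≥ 2`; `w` continuous,
`0 < m ≤ w ≤ M`.  There is a closing assignment `(l, T, C)` of `(ℤ/L)^d` (the maximally closing order of
`TorusClosingLinks`; `Σ_ℓ (#Cℓ − 1) = k_min(d, L)`) such that, for the target `π = (F/Z)·Haar^{⊗E}` and the
all-closing proposal `q = (∏_ℓ q_ℓ)·Haar^{⊗E}` along it, every bounded measurable `π`-centred observable of the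
exact sampler has `τ_int(f) ≤ (M/m)^{k_min(d,L)} − 1/2`, `k_min(d, L) = (d−1)(d−2)/2·L^d + (d−1)` — the ceiling
of the OPTIMAL one-plaquette heat-bath sampler (`AutoregressiveGaugeHeatBathOptimal`, GEN-25), via
`allClosing_autocorrelation` and `K ≤ (M/m)^{k_min}`. [ours] -/
theorem exists_allClosing_sampler_ceiling (hL : 2 ≤ L) {w : G → ℝ} (hw : Continuous w) {m M : ℝ}
    (hm0 : 0 < m) (hm : ∀ g, m ≤ w g) (hM : ∀ g, w g ≤ M) :
    ∃ (l : List (Edge d L)) (T : Finset (Edge d L)) (C : Edge d L → Finset (Plaquette d L)),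
      l.Nodup ∧ (∀ e : Edge d L, e ∈ l) ∧
      (∀ ℓ ∈ T, ∀ p ∈ C ℓ, ℓ ∈ ({(p.1, p.2.1.1), (p.1.shift p.2.1.1, p.2.1.2),
        (p.1.shift p.2.1.2, p.2.1.1), (p.1, p.2.1.2)} : Finset (Edge d L)) ∧
        ∀ e ∈ ({(p.1, p.2.1.1), (p.1.shift p.2.1.1, p.2.1.2),
        (p.1.shift p.2.1.2, p.2.1.1), (p.1, p.2.1.2)} : Finset (Edge d L)), e ≠ ℓ → l.idxOf e < l.idxOf ℓ) ∧
      (∀ p : Plaquette d L, ∃ ℓ ∈ T, p ∈ C ℓ) ∧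
      (∑ ℓ ∈ T, ((C ℓ).card - 1) = (d - 1) * (d - 2) / 2 * L ^ d + (d - 1)) ∧
      ∀ (π q : Measure (GaugeConfig d L G)) [IsProbabilityMeasure π] [IsProbabilityMeasure q],
        π = (Measure.pi fun _ : Edge d L => haarProbability G).withDensity (fun U =>
          ENNReal.ofReal ((∏ p : Plaquette d L, w (plaquetteHolonomy U p.1 p.2.1.1 p.2.1.2)) /
            ∫ V, ∏ p : Plaquette d L, w (plaquetteHolonomy V p.1 p.2.1.1 p.2.1.2) ∂(Measure.pi fun _ : Edge d L => haarProbability G))) →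
        q = (Measure.pi fun _ : Edge d L => haarProbability G).withDensity (fun U =>
          ENNReal.ofReal (∏ ℓ ∈ T, (∏ p ∈ C ℓ, w (plaquetteHolonomy U p.1 p.2.1.1 p.2.1.2)) /
            (∫ v, ∏ p ∈ C ℓ, w (plaquetteHolonomy (update U ℓ v) p.1 p.2.1.1 p.2.1.2) ∂(haarProbability G)))) →
        ∀ (f : GaugeConfig d L G → ℝ), Measurable f → ∀ Cf : ℝ, (∀ x, |f x| ≤ Cf) →
          ∫ U, f U ∂π = 0 →
          tauInt (fun t => autocov (indepMH q fun U => (((∫ V, ∏ p : Plaquette d L, w (plaquetteHolonomy V p.1 p.2.1.1 p.2.1.2) ∂(Measure.pi fun _ : Edge d L => haarProbability G)) /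
            ∏ ℓ ∈ T, (∫ v, ∏ p ∈ C ℓ, w (plaquetteHolonomy (update U ℓ v) p.1 p.2.1.1 p.2.1.2) ∂(haarProbability G)))⁻¹)) π f t /
              autocov (indepMH q fun U => (((∫ V, ∏ p : Plaquette d L, w (plaquetteHolonomy V p.1 p.2.1.1 p.2.1.2) ∂(Measure.pi fun _ : Edge d L => haarProbability G)) /
            ∏ ℓ ∈ T, (∫ v, ∏ p ∈ C ℓ, w (plaquetteHolonomy (update U ℓ v) p.1 p.2.1.1 p.2.1.2) ∂(haarProbability G)))⁻¹)) π f 0) ≤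
            (M / m) ^ ((d - 1) * (d - 2) / 2 * L ^ d + (d - 1)) - 1 / 2 := by
  obtain ⟨l, T, C, hnodup, hall, hne, hCe, hCpos, hdisj, hcover, hsum⟩ :=
    exists_closingAssignment_kmin (d := d) (L := L) hL
  refine ⟨l, T, C, hnodup, hall, fun ℓ hℓ p hp => ⟨hCe ℓ hℓ p hp, hCpos ℓ hℓ p hp⟩, hcover, hsum, ?_⟩
  intro π q _ _ hπ hq f hf Cf hCf hf0
  have hmain := allClosing_autocorrelation (G := G) hL hw hm0 hm hM T C hne hCe hdisj hcover π q hπ hq hf hCf hf0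
  have hK := allClosing_constant_le (d := d) (L := L) hw hm0 hm hM T C hne
  rw [hsum] at hK
  exact hmain.2.trans (by linarith)

end Sampler

end Summit.Ventures.LatticeQCDFlow.Theory2.Autoregressive
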